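import Summits.Ventures.GridStability.Models.InverterPLLDivergence
import Summits.Ventures.GridStability.Models.InverterPLLClosedLoop

/-!
# GridStability/Models/InverterPLLClosedLoopDivergence — the divergence regions and the outer basin strip of the PLL swing equation READ IN PLL UNITS (rider to «G3.d-PLL-DIVERGE-OUTER» through the closed-loop dictionary)

Cell `gridfusion` (LADDER-GRIDFUSION, apex-line rung G3.d; seat gridfusion-model-3 (g7); composes
`Models/InverterPLLDivergence.lean` (p522699, the #75-cand object: wind-up variable `u = ω + α sin θ`,
`u̇ = I − sin θ + D ω`, divergence for `u > u⁺` / `u < −u⁻`, outer strip) with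
`Models/InverterPLLClosedLoop.lean` (p523722, the COMPOSED SRF-PLL closed loop
[cite: HenriquezAuba2022, eqs. (2.61a)–(2.61c)] + [cite: Qoria2020, eq. (II-20)] with `ω_g := ω_pll`, and its
rescaling `isSolution_genSwingOf` to the printed dimensionless form [cite: DuEtAl2024, Eq. (1)])).

WHAT THIS FILE CERTIFIES. Pulling the two thresholds back through `τ = σ t`, `ω = Ω_b x/σ`
(`σ² = k^i V_e Ω_b/μ`, `μ = 1 − k^p L_g i_d`) gives them IN PLL UNITS, with no square root left:
`u − u⁺ = (Ω_b/σ)(x − x⁺(θ))`, `u + u⁻ = (Ω_b/σ)(x − x⁻(θ))` (`windup_sub_eq`, `windup_add_eq`) where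
`x = ω_pll − ω_s` is the frequency mismatch [pu] and
`x⁺(θ) = (k^p V_e/μ)(1 − sin θ) + (V_e − R_g i_q − ω_s L_g i_d)/(L_g i_d)`,
`x⁻(θ) = −(k^p V_e/μ)(1 + sin θ) − (V_e + R_g i_q + ω_s L_g i_d)/(L_g i_d)`.
Hence, for `μ > 0`, `k^i > 0`, `V_e > 0`, `Ω_b > 0`, `k^p ≥ 0` and ACTIVE CURRENT INTO AN INDUCTIVE
BRANCH `L_g i_d > 0` (the anti-damping sign, `SrfPll.dimD_pos_iff`), along every closed-loop solution:
* `tendsto_freqMismatch_atTop`: `ω_pll − ω_s > x⁺(θ)` at ONE instant ⇒ `ω_pll − ω_s → +∞`;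
* `tendsto_freqMismatch_atBot`: `ω_pll − ω_s < x⁻(θ)` at one instant ⇒ `ω_pll − ω_s → −∞`;
* `freqMismatch_mem_Icc_of_tendsto`: every closed-loop motion whose PLL frequency has a finite limit
  (⊇ the attracting basin of the locked state) satisfies `x⁻(θ(t)) ≤ ω_pll(t) − ω_s ≤ x⁺(θ(t))` at ALL
  times. Reading: the divergence threshold SHRINKS as `L_g i_d` grows (weaker grid × more active
  current) — at `sin θ = 1` it is exactly `(V_e − R_g i_q)/(L_g i_d) − ω_s`.

THREE COLUMNS. CERTIFIED: the theorems (std axioms). MODELLED + COMPOSED exactly as the two imported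
files (quasi-static branch, algebraic current loops, `ω_g := ω_pll`, no PLL filter / normalisation /
LIMITER — MODEL-VALIDITY MV-INV-3, MV-6P); in a device the frequency/integrator limiter interrupts the
divergence certified for the MODEL. VALIDATED: nothing here. No parameter values (model-4 custody); no
sentence says a converter or a grid is stable or unstable.
-/

noncomputable section

open Real Set Filter Topology

namespace Summit.Ventures.GridStability.Models.InverterPLL.SrfPll

variable (L : SrfPll) (B : PccBranch)

/-- Upper divergence threshold of the frequency mismatch, in PLL units:
`x⁺(θ) = (k^p V_e/μ)(1 − sin θ) + (V_e − R_g i_q − ω_s L_g i_d)/(L_g i_d)`. -/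
def xUp (θ : ℝ) : ℝ :=
  L.kp * B.Ve / L.loopFactor B * (1 - sin θ)
    + (B.Ve - B.Rg * B.igq - L.ωs * B.Lg * B.igd) / (B.Lg * B.igd)

/-- Lower divergence threshold of the frequency mismatch, in PLL units:
`x⁻(θ) = −(k^p V_e/μ)(1 + sin θ) − (V_e + R_g i_q + ω_s L_g i_d)/(L_g i_d)`. -/
def xDown (θ : ℝ) : ℝ :=
  -(L.kp * B.Ve / L.loopFactor B * (1 + sin θ))
    - (B.Ve + B.Rg * B.igq + L.ωs * B.Lg * B.igd) / (B.Lg * B.igd)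

variable {L B}

/-- Pull-back of the wind-up excess: `u − u⁺ = (Ω_b/σ)(x − x⁺(θ))` for the rescaled state
`ω = (Ω_b/σ) x` of `genSwingOf`. -/
theorem windup_sub_eq (hμ : 0 < L.loopFactor B) (hki : 0 < L.ki) (hVe : 0 < B.Ve) (hΩ : 0 < L.Ωb)
    (hLi : 0 < B.Lg * B.igd) (θ x : ℝ) :
    (L.genSwingOf B).windup θ (L.Ωb / L.sigma B * x) - (L.genSwingOf B).divergeUp
      = L.Ωb / L.sigma B * (x - L.xUp B θ) := by
  have hrad : 0 < L.ki * B.Ve * L.Ωb / L.loopFactor B := div_pos (by positivity) hμ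
  have hσ : 0 < L.sigma B := L.sigma_pos B hrad
  have hσ2 := L.sigma_sq B hrad
  have hμ0 := hμ.ne'
  have hσ0 := hσ.ne'
  have hLi0 : B.Lg * B.igd ≠ 0 := hLi.ne'
  simp only [GenSwing.windup, GenSwing.divergeUp, genSwingOf, dimI, dimD, dimAlpha, xUp]
  field_simp
  rw [hσ2]
  field_simp
  ring

/-- Pull-back of the lower wind-up margin: `u + u⁻ = (Ω_b/σ)(x − x⁻(θ))`. -/
theorem windup_add_eq (hμ : 0 < L.loopFactor B) (hki : 0 < L.ki) (hVe : 0 < B.Ve) (hΩ : 0 < L.Ωb)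
    (hLi : 0 < B.Lg * B.igd) (θ x : ℝ) :
    (L.genSwingOf B).windup θ (L.Ωb / L.sigma B * x) + (L.genSwingOf B).divergeDown
      = L.Ωb / L.sigma B * (x - L.xDown B θ) := by
  have hrad : 0 < L.ki * B.Ve * L.Ωb / L.loopFactor B := div_pos (by positivity) hμ
  have hσ : 0 < L.sigma B := L.sigma_pos B hrad
  have hσ2 := L.sigma_sq B hrad
  have hμ0 := hμ.ne'
  have hσ0 := hσ.ne'
  have hLi0 : B.Lg * B.igd ≠ 0 := hLi.ne'
  simp only [GenSwing.windup, GenSwing.divergeDown, genSwingOf, dimI, dimD, dimAlpha, xDown]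
  field_simp
  rw [hσ2]
  field_simp
  ring

/-- From the rescaled time back to physical time: if `τ ↦ c · x(τ/σ)` tends to a filter `l` along
`atTop` (`σ > 0`), then so does `t ↦ c · x(t)`. -/
private theorem tendsto_of_rescaled {x : ℝ → ℝ} {σ : ℝ} (c : ℝ) (hσ : 0 < σ) {l : Filter ℝ}
    (h : Tendsto (fun τ => c * x (τ / σ)) atTop l) : Tendsto (fun t => c * x t) atTop l := by
  have hcomp := h.comp (tendsto_id.const_mul_atTop hσ)
  refine hcomp.congr fun t => ?_
  simp only [Function.comp, id]
  rw [mul_div_cancel_left₀ t hσ.ne']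

/-- **Divergence to `+∞` in PLL units.** For `μ = 1 − k^p L_g i_d > 0`, `k^i > 0`, `V_e > 0`,
`Ω_b > 0`, `k^p ≥ 0`, `L_g i_d > 0`: if along a closed-loop solution the frequency mismatch exceeds
`x⁺(θ) = (k^p V_e/μ)(1 − sin θ) + (V_e − R_g i_q − ω_s L_g i_d)/(L_g i_d)` at ONE instant, then
`ω_pll − ω_s → +∞`. MODELLED + COMPOSED (no limiter). -/
theorem tendsto_freqMismatch_atTop (hμ : 0 < L.loopFactor B) (hki : 0 < L.ki) (hVe : 0 < B.Ve)
    (hΩ : 0 < L.Ωb) (hkp : 0 ≤ L.kp) (hLi : 0 < B.Lg * B.igd) {θ ε : ℝ → ℝ}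
    (h : L.IsClosedLoopSolution B θ ε) {t₀ : ℝ}
    (h0 : L.xUp B (θ t₀) < L.freqMismatch B (θ t₀) (ε t₀)) :
    Tendsto (fun t => L.freqMismatch B (θ t) (ε t)) atTop atTop := by
  have hrad : 0 < L.ki * B.Ve * L.Ωb / L.loopFactor B := div_pos (by positivity) hμ
  have hσ : 0 < L.sigma B := L.sigma_pos B hrad
  have hsol := L.isSolution_genSwingOf B hμ (by positivity) hVe.ne' h
  have hD : 0 < (L.genSwingOf B).D := by
    show 0 < L.dimD B
    rw [L.dimD_pos_iff B hμ hσ]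
    have : 0 < L.ki * (B.Lg * B.igd) := mul_pos hki hLi
    linarith [mul_assoc L.ki B.Lg B.igd]
  have hα : 0 ≤ (L.genSwingOf B).α := by
    show 0 ≤ L.dimAlpha B
    unfold dimAlpha
    positivity
  have hc : 0 < L.Ωb / L.sigma B := div_pos hΩ hσ
  -- the wind-up excess at τ₀ = σ t₀ is positive
  have hwin : (L.genSwingOf B).divergeUp
      < (L.genSwingOf B).windup (θ (L.sigma B * t₀ / L.sigma B))
          (L.Ωb / L.sigma B * L.freqMismatch B (θ (L.sigma B * t₀ / L.sigma B))
            (ε (L.sigma B * t₀ / L.sigma B))) := by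
    rw [mul_div_cancel_left₀ t₀ hσ.ne']
    have := windup_sub_eq hμ hki hVe hΩ hLi (θ t₀) (L.freqMismatch B (θ t₀) (ε t₀))
    have hpos : 0 < L.Ωb / L.sigma B * (L.freqMismatch B (θ t₀) (ε t₀) - L.xUp B (θ t₀)) :=
      mul_pos hc (by linarith)
    linarith
  have hdiv := GenSwing.tendsto_freq_atTop_of_windup_gt hD hα hsol hwin
  have hx := tendsto_of_rescaled (x := fun s => L.freqMismatch B (θ s) (ε s)) (L.Ωb / L.sigma B) hσ hdiv
  -- remove the positive factor Ω_b/σ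
  have := hx.atTop_mul_const' (r := (L.Ωb / L.sigma B)⁻¹) (inv_pos.2 hc)
  refine this.congr fun t => ?_
  field_simp

/-- **Divergence to `−∞` in PLL units.** Under the same signs: if at one instant
`ω_pll − ω_s < x⁻(θ) = −(k^p V_e/μ)(1 + sin θ) − (V_e + R_g i_q + ω_s L_g i_d)/(L_g i_d)`, then
`ω_pll − ω_s → −∞`. MODELLED + COMPOSED (no limiter). -/
theorem tendsto_freqMismatch_atBot (hμ : 0 < L.loopFactor B) (hki : 0 < L.ki) (hVe : 0 < B.Ve)
    (hΩ : 0 < L.Ωb) (hkp : 0 ≤ L.kp) (hLi : 0 < B.Lg * B.igd) {θ ε : ℝ → ℝ}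
    (h : L.IsClosedLoopSolution B θ ε) {t₀ : ℝ}
    (h0 : L.freqMismatch B (θ t₀) (ε t₀) < L.xDown B (θ t₀)) :
    Tendsto (fun t => L.freqMismatch B (θ t) (ε t)) atTop atBot := by
  have hrad : 0 < L.ki * B.Ve * L.Ωb / L.loopFactor B := div_pos (by positivity) hμ
  have hσ : 0 < L.sigma B := L.sigma_pos B hrad
  have hsol := L.isSolution_genSwingOf B hμ (by positivity) hVe.ne' h
  have hD : 0 < (L.genSwingOf B).D := by
    show 0 < L.dimD B
    rw [L.dimD_pos_iff B hμ hσ]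
    have : 0 < L.ki * (B.Lg * B.igd) := mul_pos hki hLi
    linarith [mul_assoc L.ki B.Lg B.igd]
  have hα : 0 ≤ (L.genSwingOf B).α := by
    show 0 ≤ L.dimAlpha B
    unfold dimAlpha
    positivity
  have hc : 0 < L.Ωb / L.sigma B := div_pos hΩ hσ
  have hwin : (L.genSwingOf B).windup (θ (L.sigma B * t₀ / L.sigma B))
        (L.Ωb / L.sigma B * L.freqMismatch B (θ (L.sigma B * t₀ / L.sigma B))
          (ε (L.sigma B * t₀ / L.sigma B)))
      < -(L.genSwingOf B).divergeDown := by
    rw [mul_div_cancel_left₀ t₀ hσ.ne']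
    have := windup_add_eq hμ hki hVe hΩ hLi (θ t₀) (L.freqMismatch B (θ t₀) (ε t₀))
    have hneg : L.Ωb / L.sigma B * (L.freqMismatch B (θ t₀) (ε t₀) - L.xDown B (θ t₀)) < 0 :=
      mul_neg_of_pos_of_neg hc (by linarith)
    linarith
  have hdiv := GenSwing.tendsto_freq_atBot_of_windup_lt hD hα hsol hwin
  have hx := tendsto_of_rescaled (x := fun s => L.freqMismatch B (θ s) (ε s)) (L.Ωb / L.sigma B) hσ hdiv
  have := hx.atBot_mul_const' (r := (L.Ωb / L.sigma B)⁻¹) (inv_pos.2 hc)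
  refine this.congr fun t => ?_
  field_simp

/-- **Outer strip in PLL units.** Under the same signs, every closed-loop motion whose frequency
mismatch has a finite limit — in particular every motion attracted by the locked state — satisfies
`x⁻(θ(t)) ≤ ω_pll(t) − ω_s ≤ x⁺(θ(t))` at EVERY time `t`: the attracting basin of the locked state of
the COMPOSED SRF-PLL model lies inside this strip. MODELLED + COMPOSED. -/
theorem freqMismatch_mem_Icc_of_tendsto (hμ : 0 < L.loopFactor B) (hki : 0 < L.ki)
    (hVe : 0 < B.Ve) (hΩ : 0 < L.Ωb) (hkp : 0 ≤ L.kp) (hLi : 0 < B.Lg * B.igd) {θ ε : ℝ → ℝ}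
    (h : L.IsClosedLoopSolution B θ ε) {w : ℝ}
    (hw : Tendsto (fun t => L.freqMismatch B (θ t) (ε t)) atTop (𝓝 w)) (t : ℝ) :
    L.freqMismatch B (θ t) (ε t) ∈ Icc (L.xDown B (θ t)) (L.xUp B (θ t)) := by
  constructor
  · by_contra hlt
    exact (hw.not_tendsto (disjoint_nhds_atBot w))
      (tendsto_freqMismatch_atBot hμ hki hVe hΩ hkp hLi h (not_le.mp hlt))
  · by_contra hlt
    exact (hw.not_tendsto (disjoint_nhds_atTop w))
      (tendsto_freqMismatch_atTop hμ hki hVe hΩ hkp hLi h (not_le.mp hlt))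

end Summit.Ventures.GridStability.Models.InverterPLL.SrfPll

end
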